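import Summits.Langlands.Langlands.Theorems.PhantomRMYoshidaSerreKWAutomorphicGL2DictionaryL
import HarnessLib

/-! # Stub stub_dictionaryC of line Sketch (crux stmt-Langlands-15112 `ParityBlindBianchi.ResidualBianchiDoorLevel`)

The C-normalised dictionary for a newform `f ∈ S_k(Γ₁(N))`, `k ≥ 2` even: if a cuspidal
Borel–Jacquet datum `π = W / W'` on `GL₂(𝔸_ℚ)` contains the adelic lift `φ_f` in `W ∖ W'` and has
archimedean parameter `{(k-1)/2, (1-k)/2}`, then the finite-order twist `π₂ = π ⊗ (ε⁻¹ ∘ det)`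
(`ε` the nebentypus of `f`, NO norm twist) is a regular algebraic cuspidal datum whose Satake
multiset at almost every finite place `v = q` is `{(√q)^{k-1} β₁⁻¹, (√q)^{k-1} β₂⁻¹}`, `β₁, β₂` the
complex roots of the Hecke polynomial `X² - a_q X + ε(q) q^{k-1}`.

* The infinity type `{((k-1)/2, (1-k)/2), ((1-k)/2, (k-1)/2)}` is C-algebraic for `GL₂` exactly when
  `k` is even (exponents in `1/2 + ℤ`) and regular as soon as `k ≠ 1` (Buzzard–Gee 2014, §3.1;
  Clozel's "algébrique régulière").
* At `v ∤ N`, `π` has the unitary Satake pair `{x, y}`, `x + y = a_q (√q)^{1-k}`, `xy = ε(q)`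
  (`hasSatakeParamAt_pair_of_adelicLiftFunA_mem`, Part I of the landed `stub_dictionaryL`;
  Gelbart 1975, Lemma 3.7); the twist by `ofDirichlet ε⁻¹` multiplies the pair by `ε(q)⁻¹`
  (Arthur–Clozel 1989, Ch. 3, proof of Thm. 3.1), giving `{y⁻¹, x⁻¹} = {(√q)^{k-1} β⁻¹}` since
  `β = (√q)^{k-1} {x, y}` by Vieta.
-/

noncomputable section

open scoped MatrixGroups Classical Polynomial
open NumberField IsDedekindDomain Filter Polynomial CongruenceSubgroup
open Literature.NumberTheory.Automorphic Literature.NumberTheory.EllipticCurves.ModularForms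
  Literature.NumberTheory.GaloisRepresentations
open Rat.HeightOneSpectrum

namespace Summit.Langlands.Langlands.Cruxes.ResidualBianchiDoorLevel.Sketch

set_option linter.dupNamespace false

/-! ## Bookkeeping lemmas -/

/-- **The infinity type of the weight-`k` discrete series in the unitary normalisation is regular
algebraic for even `k`.** There is a well-formed infinity type `T` on `GL₂/ℚ` with `a`-exponents
`{(k-1)/2, (1-k)/2}` (weights `((k-1)/2, (1-k)/2)`, `((1-k)/2, (k-1)/2)`, swap-stable); for
`k = 2m` its exponents `m - 1 + 1/2`, `-m + 1/2` lie in `(2-1)/2 + ℤ` (C-algebraic) and are distinct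
(`k ≠ 1`), i.e. `T` is regular algebraic in the sense of Clozel
(Buzzard–Gee 2014, §3.1). [cite: BuzzardGeeLMS2014, Def. 3.1.1 and §3.4] -/
theorem exists_infinityType_isRegularAlgebraic (k : ℤ) (hk : Even k) :
    ∃ T : InfinityType ℚ 2, T.IsWellFormed ∧
      (fun σ => (T σ).map ArchWeight.a) =
        (fun _ => ({((k : ℂ) - 1) / 2, (1 - (k : ℂ)) / 2} : Multiset ℂ)) ∧
      T.IsRegularAlgebraic := by
  obtain ⟨m, hm⟩ := hk
  have hkc : (k : ℂ) = (m : ℂ) + m := by rw [hm, Int.cast_add]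
  let w₁ : ArchWeight := ⟨((k : ℂ) - 1) / 2, (1 - (k : ℂ)) / 2, k - 1, by push_cast; ring⟩
  let w₂ : ArchWeight := ⟨(1 - (k : ℂ)) / 2, ((k : ℂ) - 1) / 2, 1 - k, by push_cast; ring⟩
  have hsw₁ : w₁.swap = w₂ := rfl
  have hsw₂ : w₂.swap = w₁ := rfl
  have ha₁ : w₁.a = ((k : ℂ) - 1) / 2 := rfl
  have hb₁ : w₁.b = (1 - (k : ℂ)) / 2 := rfl
  have ha₂ : w₂.a = (1 - (k : ℂ)) / 2 := rfl
  have hb₂ : w₂.b = ((k : ℂ) - 1) / 2 := rfl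
  refine ⟨fun _ => {w₁, w₂}, ⟨fun _ => rfl, fun σ => ?_⟩, ?_, ?_, ?_⟩
  · simp only [Multiset.insert_eq_cons, Multiset.map_cons, Multiset.map_singleton, hsw₁, hsw₂]
    exact Multiset.cons_swap w₁ w₂ 0
  · funext σ
    simp only [Multiset.insert_eq_cons, Multiset.map_cons, Multiset.map_singleton]
    rfl
  · -- C-algebraic: exponents in `1/2 + ℤ` since `k = 2m`
    intro σ p hp
    simp only [Multiset.insert_eq_cons, Multiset.mem_cons, Multiset.mem_singleton] at hp
    rcases hp with rfl | rfl
    · refine ⟨m - 1, -m, ?_, ?_⟩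
      · rw [ha₁, hkc]; push_cast; ring
      · rw [hb₁, hkc]; push_cast; ring
    · refine ⟨-m, m - 1, ?_, ?_⟩
      · rw [ha₂, hkc]; push_cast; ring
      · rw [hb₂, hkc]; push_cast; ring
  · -- regular: `(k-1)/2 ≠ (1-k)/2` as `k ≠ 1`
    intro σ
    simp only [Multiset.insert_eq_cons, Multiset.map_cons, Multiset.map_singleton,
      Multiset.nodup_cons, Multiset.mem_singleton, Multiset.nodup_singleton, and_true, ha₁, ha₂]
    intro h
    have h1 : (k : ℂ) = 1 := by linear_combination h
    have h2 : k = 1 := by exact_mod_cast h1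
    omega

/-- The Hecke polynomial `X² - a X + e q^{m}` factors as `(X - B x)(X - B y)` with `B = (√q)^m`
when `x + y = a B⁻¹`, `xy = e` (Vieta). [folklore] -/
private theorem heckePolynomial_eq_prod_of_pair {q m : ℕ} {a e x y : ℂ}
    (hB : (((Real.sqrt q : ℝ) : ℂ)) ≠ 0)
    (hxy : x + y = a * ((((Real.sqrt q : ℝ) : ℂ)) ^ m)⁻¹) (hxy' : x * y = e) :
    (X ^ 2 - C a * X + C (e * (q : ℂ) ^ m) : ℂ[X]) =
      (({(((Real.sqrt q : ℝ) : ℂ)) ^ m * x, (((Real.sqrt q : ℝ) : ℂ)) ^ m * y} : Multiset ℂ).map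
        fun t => X - C t).prod := by
  -- adapted from `SerreKWAutomorphicGL2.AdelicNewformDatumDoubleTwist.heckePolynomial_eq_prod_of_pair`
  set B : ℂ := (((Real.sqrt q : ℝ) : ℂ)) ^ m with hBdef
  have hBm : B ≠ 0 := pow_ne_zero _ hB
  have hsq : (((Real.sqrt q : ℝ) : ℂ)) ^ 2 = (q : ℂ) := by
    rw [← Complex.ofReal_pow, Real.sq_sqrt (Nat.cast_nonneg q), Complex.ofReal_natCast]
  have hB2 : B * B = (q : ℂ) ^ m := by
    rw [hBdef, ← pow_add, ← two_mul, pow_mul, hsq]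
  have h1 : B * x + B * y = a := by
    rw [← mul_add, hxy, mul_left_comm, mul_inv_cancel₀ hBm, mul_one]
  have h2 : B * x * (B * y) = e * (q : ℂ) ^ m := by
    rw [← hB2, ← hxy']; ring
  simp only [Multiset.insert_eq_cons, Multiset.map_cons, Multiset.map_singleton,
    Multiset.prod_cons, Multiset.prod_singleton]
  rw [← h1, ← h2]
  simp only [map_add, map_mul]
  ring

/-- The C-normalised inverted roots: `{e⁻¹ x, e⁻¹ y} = {B (B x)⁻¹, B (B y)⁻¹}` when `xy = e ≠ 0`,
`B ≠ 0`. [folklore] -/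
private theorem map_pair_eq {B e x y : ℂ} (hB : B ≠ 0) (hx : x ≠ 0) (hy : y ≠ 0)
    (hxy' : x * y = e) :
    Multiset.map (fun t => e⁻¹ * t) ({x, y} : Multiset ℂ) =
      Multiset.map (fun t => B * t⁻¹) ({B * x, B * y} : Multiset ℂ) := by
  have e1 : e⁻¹ * x = B * (B * y)⁻¹ := by rw [← hxy']; field_simp
  have e2 : e⁻¹ * y = B * (B * x)⁻¹ := by rw [← hxy']; field_simp
  simp only [Multiset.insert_eq_cons, Multiset.map_cons, Multiset.map_singleton, e1, e2]
  exact Multiset.pair_comm _ _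

/-! ## The stub -/

/-- **Stub `stub_dictionaryC` (C-normalised dictionary).**  Let `f ∈ S_k(Γ₁(N))`, `k ≥ 2` EVEN, be a
newform and `π = W / W'` a cuspidal datum on `GL₂(𝔸_ℚ)` with `φ_f ∈ W ∖ W'` and archimedean parameter
`{(k-1)/2, (1-k)/2}`.  Then the finite-order twist `π₂ := π ⊗ (ofDirichlet ε⁻¹ ∘ det)` (`ε` the
nebentypus; NO norm twist) is a REGULAR ALGEBRAIC cuspidal datum (infinity type
`{((k-1)/2,(1-k)/2), ((1-k)/2,(k-1)/2)}`: exponents in `1/2 + ℤ` because `k` is even, distinct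
because `k ≠ 1`) whose Satake parameter at almost every finite place `v = q` is
`{(√q)^{k-1} β₁⁻¹, (√q)^{k-1} β₂⁻¹} = {x⁻¹, y⁻¹}`, `β_{1,2} = (√q)^{k-1}{x, y}` the complex roots of the
Hecke polynomial `X² - a_q X + ε(q) q^{k-1}` and `{x, y}` the unitary pair of Part I of the landed
`stub_dictionaryL` (`hasSatakeParamAt_pair_of_adelicLiftFunA_mem`; then
`eventually_hasSatakeParamAt_twist`, `valueAtUniformizer_ofDirichlet`, `HasArchParameter.twist`).
[cite: Gelbart1975, §3 Lemma 3.7] [cite: BuzzardGeeLMS2014, Def. 3.1.1 and §3.4]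
[cite: ArthurClozelAMS120, Ch. 3, proof of Thm. 3.1 (p. 172)] -/
theorem stub_dictionaryC :
    ∀ (N : ℕ) [NeZero N] (k : ℤ), 2 ≤ k → Even k → ∀ (f : CuspForm (Gamma1 N) k), IsNewform1 f →
      ∀ (hcpt : isCompact_glFiniteIntegralLevel 2 ℚ) (π : CuspidalAutomorphicRepData 2 ℚ hcpt),
        adelicLiftFunA N k ⇑f ∈ π.1.W → adelicLiftFunA N k ⇑f ∉ π.1.W' →
        π.1.HasArchParameter (fun _ => ({((k : ℂ) - 1) / 2, (1 - (k : ℂ)) / 2} : Multiset ℂ)) →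
          ∃ π₂ : CuspidalAutomorphicRepData 2 ℚ hcpt, π₂.1.IsRegularAlgebraic ∧
            ∀ᶠ v : HeightOneSpectrum (𝓞 ℚ) in Filter.cofinite,
              π₂.1.HasSatakeParamAt v
                (((heckePolynomial f ((Rat.HeightOneSpectrum.primesEquiv v : Nat.Primes) : ℕ)).map
                    (algebraMap (coeffCharField f) ℂ)).roots.map
                  (fun β => (((Real.sqrt ((Rat.HeightOneSpectrum.primesEquiv v : Nat.Primes) : ℕ)
                    : ℝ) : ℂ)) ^ (k - 1) * β⁻¹)) := by
  intro N _ k hk hke f hf hcpt π hW hW' harch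
  obtain ⟨m, hm⟩ : ∃ m : ℕ, k - 1 = m := ⟨(k - 1).toNat, (Int.toNat_of_nonneg (by omega)).symm⟩
  -- (ii) the finite-order twist by `ε⁻¹ ∘ det`
  set ε : DirichletCharacter ℂ N := nebentypus f
  set χ₁ : HeckeCharacter ℚ := HeckeCharacter.ofDirichlet ε⁻¹ with hχ₁def
  have hχ₁ : χ₁.IsFiniteOrder := HeckeCharacter.isFiniteOrder_ofDirichlet ε⁻¹
  set π₂ : CuspidalAutomorphicRepData 2 ℚ hcpt := π.twist χ₁ hχ₁
  have harch₂ :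
      π₂.1.HasArchParameter (fun _ => ({((k : ℂ) - 1) / 2, (1 - (k : ℂ)) / 2} : Multiset ℂ)) :=
    AutomorphicRepData.HasArchParameter.twist π.1 χ₁ hχ₁ harch
  -- (i') the infinity type: regular algebraic since `k` is even
  obtain ⟨T, hTwf, hTa, hTRA⟩ := exists_infinityType_isRegularAlgebraic k hke
  have hT₂ : π₂.1.HasInfinityType T := ⟨hTwf, hTa ▸ harch₂⟩
  refine ⟨π₂, ⟨T, hT₂, hTRA⟩, ?_⟩
  -- the Satake parameters at almost every `v`
  have h1 := AutomorphicRepData.eventually_hasSatakeParamAt_twist π.1 hχ₁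
  have h2 : ∀ᶠ v : HeightOneSpectrum (𝓞 ℚ) in cofinite,
      ¬ v.asIdeal ∣ Ideal.span {(N : 𝓞 ℚ)} := by
    rw [eventually_cofinite]
    simpa only [not_not] using Ideal.finite_factors (Rat.span_natCast_ne_zero N)
  filter_upwards [h1, h2] with v hv₁ hv
  -- notation at `v`: `q`, `a = a_q`, `e = ε(q)`, `r = √q`
  have hq : ((Rat.HeightOneSpectrum.primesEquiv v : Nat.Primes) : ℕ) = natGenerator v := rfl
  rw [hq]
  have hqp : (natGenerator v).Prime := prime_natGenerator v
  haveI : NeZero (natGenerator v) := ⟨hqp.ne_zero⟩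
  have hqN : ¬ natGenerator v ∣ N := fun h => hv ((Rat.natGenerator_dvd_iff v N).1 h)
  have hs0 : ((Real.sqrt (natGenerator v) : ℝ) : ℂ) ≠ 0 := by
    exact_mod_cast (Real.sqrt_pos.2 (Nat.cast_pos.2 hqp.pos)).ne'
  -- (i) the eigenvalues of the newform and the unitary pair
  have hT : heckeT (Gamma1 N) k (natGenerator v) f =
      (UpperHalfPlane.qExpansion 1 ⇑f).coeff (natGenerator v) • f := by
    rw [← IsNewform1.heckeEigenvalue_eq_coeff_holds hf hqp]
    exact heckeT_eq_heckeEigenvalue_smul f (natGenerator v) (hf.2.1 _ hqp)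
  have hD : diamondOp N k ((natGenerator v : ℕ) : ZMod N) f = ε (natGenerator v : ZMod N) • f :=
    hf.diamondOp_natCast_apply_of_not_dvd hqp hqN
  have he : ε (natGenerator v : ZMod N) ≠ 0 :=
    ((ZMod.isUnit_prime_of_not_dvd hqp hqN).map ε).ne_zero
  obtain ⟨x, y, hxy, hxy'⟩ := exists_pair_add_eq_mul_eq
    ((UpperHalfPlane.qExpansion 1 ⇑f).coeff (natGenerator v) *
      ((((Real.sqrt (natGenerator v) : ℝ) : ℂ)) ^ m)⁻¹) (ε (natGenerator v : ZMod N))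
  have hx : x ≠ 0 := fun h => he (by rw [← hxy', h, zero_mul])
  have hy : y ≠ 0 := fun h => he (by rw [← hxy', h, mul_zero])
  have hsat : π.1.HasSatakeParamAt v ({x, y} : Multiset ℂ) :=
    SerreKWAutomorphicGL2.AdelicNewformDatumDoubleTwist.hasSatakeParamAt_pair_of_adelicLiftFunA_mem
      π.1 f hW hW' hv hT hD (by rw [hm, zpow_natCast]; exact hxy) hxy'
  -- (ii): the Satake parameter of the twist
  have hsat₂ := hv₁ _ hsat
  -- the multiset identity
  have hc₁ : χ₁.valueAtUniformizer v = (ε (natGenerator v : ZMod N))⁻¹ := by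
    rw [hχ₁def, HeckeCharacter.valueAtUniformizer_ofDirichlet ε⁻¹ hqN,
      Literature.NumberTheory.GaloisRepresentations.Rat.residueCard_eq_natGenerator,
      MulChar.inv_apply_eq_inv']
  rw [hc₁, map_pair_eq (pow_ne_zero m hs0) hx hy hxy'] at hsat₂
  rw [map_heckePolynomial, hm, zpow_natCast, zpow_natCast,
    heckePolynomial_eq_prod_of_pair hs0 hxy hxy', Polynomial.roots_multiset_prod_X_sub_C]
  exact hsat₂

end Summit.Langlands.Langlands.Cruxes.ResidualBianchiDoorLevel.Sketch

end
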